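import Summits.Ventures.YMGap.RobustBall.OneState
import HarnessLib

/-!
# Venture YMGap, track ROBUST-BALL — the VAN HOVE JOIN, step 6: the THERMODYNAMIC LIMIT EXISTS — the whole sequence of
# periodised torus states of a member in the uniqueness regime converges to the one state (no subsequences)

HONEST FRAMING. WHAT THIS IS: a venture file (cell `pub-ymgap`, track Y2 ROBUST-BALL, seat ds-3), the perturbed twin of
the tree's `tendsto_integral_torusState_of_subsingleton_TI` (Friedli–Velenik Lemma 6.30): for a member `(W, supp)` of the
`ℤ^d` ball — continuous gauge-invariant terms reading their own links, locally finite support of range `R` — whose `ℤ^d`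
specification has AT MOST ONE Gibbs measure containing `μ`, the perturbed torus states of the PERIODISED family
(`periodisedFamily`, `PeriodisedDLR.lean`) converge ALONG THE FULL SEQUENCE of torus sizes `L + 1 → ∞` to `μ` on every
bounded continuous cylinder observable: `⟨F ∘ torusLift⟩_{β, 𝓦_W(L), L+1} → ∫ F dμ`
(`tendsto_expectation_periodisedFamily_of_subsingleton`). Proof: every subsequence has a further subsequence along which
the (compact) torus states converge to a limit state, which is a DLR state
(`mem_perturbedGibbsMeasures_of_mem_perturbedLimitPoints`), hence `μ`. Packaged with the mass gap on the gauge-invariant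
`ℤ⁴` ball: `tendsto_expectation_periodisedFamily_of_perturbedMassGapAt` — THE thermodynamic limit of a member exists and
IS its unique, massive DLR state. WHAT THIS IS NOT: no new estimate; nothing about the continuum limit or the Clay
Millennium problem.

References: S. Friedli, Y. Velenik (2017), Lemma 6.30; H.-O. Georgii (2011), Thm. 4.17; the tree's
`InfiniteVolumeSufficientIV.lean` (followed line by line); rb-p2 `PerturbedLimitStates.lean`; ds-3 `PeriodisedDLR.lean`,
`OneState.lean`.
-/

noncomputable section

open MeasureTheory Filter Topology Function Finset
open scoped NNReal
open Literature.Probability.LatticeModels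
open Literature.MathematicalPhysics.QuantumLattice hiding torusNorm
open Literature.MathematicalPhysics.QuantumFieldTheory hiding ZdEdge Site
open Literature.Barriers.QuantumFields (IsMassiveState)

namespace Summit.Ventures.YMGap.RobustBall

variable {d N : ℕ}

/-! ### Compactness along a subsequence -/

/-- **Along every sequence of torus sizes a family has a subsequential limit state** (compactness of the space of
probability measures on `SU(N)^{links(ℤ^d)}`, Lévy–Prokhorov; rb-p2's `perturbedLimitPoints_nonempty` along a subsequence).
[folklore] -/
theorem exists_isPerturbedLimitAlong_subseq (β : ℝ) (𝓦 : PerturbationFamily d N) (Ls : ℕ → ℕ) :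
    ∃ (φ : ℕ → ℕ) (μ : Measure (LGConfig d (SUN N))), StrictMono φ ∧ IsPerturbedLimitAlong β 𝓦 (Ls ∘ φ) μ := by
  haveI := fun L : ℕ => isProbabilityMeasure_perturbedTorusState (d := d) β (L + 1) (𝓦 L)
  let P : ℕ → ProbabilityMeasure (LGConfig d (SUN N)) := fun L => ⟨perturbedTorusState β (L + 1) (𝓦 L), inferInstance⟩
  obtain ⟨ν, -, φ, hφ, hlim⟩ :=
    (isCompact_univ (X := ProbabilityMeasure (LGConfig d (SUN N)))).tendsto_subseq fun n => Set.mem_univ (P (Ls n))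
  refine ⟨φ, (ν : Measure (LGConfig d (SUN N))), hφ, inferInstance, fun F S _ hFc hFb => ?_⟩
  obtain ⟨C, hC⟩ := hFb
  let Fb : BoundedContinuousFunction (LGConfig d (SUN N)) ℝ :=
    BoundedContinuousFunction.ofNormedAddCommGroup F hFc C (fun U => by simpa [Real.norm_eq_abs] using hC U)
  have hE : (fun k : ℕ => (𝓦 ((Ls ∘ φ) k)).expectation (fundamentalRep (Fin N)) β (toTorusObservable ((Ls ∘ φ) k + 1) F)) =
      fun k => ∫ U, Fb U ∂(P (Ls (φ k)) : Measure (LGConfig d (SUN N))) :=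
    funext fun k => expectation_toTorusObservable β ((Ls ∘ φ) k + 1) (𝓦 ((Ls ∘ φ) k)) hFc.measurable
  rw [hE]
  exact (ProbabilityMeasure.tendsto_iff_forall_integral_tendsto.1 hlim) Fb

/-! ### The full thermodynamic limit in the uniqueness regime -/

section Limit

variable {W : Potential (ZdEdge d) (SUN N)} {supp : Finset (ZdEdge d) → Finset (Finset (ZdEdge d))}
  (hdep : ∀ X, DependsOn (W X) (↑X : Set (ZdEdge d))) (hg : ∀ X, IsZdGaugeInvariant (W X))
  (hm : ∀ X, Measurable (W X)) (hb : ∀ X, ∃ C, ∀ U, |W X U| ≤ C)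

/-- ★ **THE THERMODYNAMIC LIMIT OF THE PERIODISED TORUS STATES EXISTS in the uniqueness regime** (every `d`, `N`, `β`):
if the member's `ℤ^d` specification has at most one Gibbs measure and `μ` is one, then for every bounded continuous
cylinder observable `F` the perturbed torus expectations of `F ∘ torusLift` along the FULL sequence of torus sizes
`L + 1 → ∞` converge to `∫ F dμ` (Friedli–Velenik Lemma 6.30 for perturbed members: every subsequence has a sub-subsequence
converging to a DLR limit state, which is `μ`). [folklore] -/
theorem tendsto_expectation_periodisedFamily_of_subsingleton (hsupp : W.IsSupportedBy supp)
    (hWc : ∀ X, Continuous (W X)) {R : ℝ} (hrange : ∀ e, ∀ X ∈ supp {e}, e ∈ X → ∀ y ∈ X, ‖e.1 - y.1‖ ≤ R) (β : ℝ)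
    (hsub : (perturbedGibbsMeasures (d := d) (fundamentalRep (Fin N)) β W supp).Subsingleton)
    {μ : Measure (LGConfig d (SUN N))} (hμ : μ ∈ perturbedGibbsMeasures (d := d) (fundamentalRep (Fin N)) β W supp)
    {F : LGConfig d (SUN N) → ℝ} {S : Finset (ZdEdge d)} (hFS : IsCylinder F S) (hFc : Continuous F)
    (hFb : ∃ C, ∀ U, |F U| ≤ C) :
    Tendsto (fun L : ℕ => (periodisedFamily W supp hdep hg hm hb L).expectation (fundamentalRep (Fin N)) β
      (toTorusObservable (L + 1) F)) atTop (𝓝 (∫ U, F U ∂μ)) := by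
  refine tendsto_of_subseq_tendsto fun ns hns => ?_
  obtain ⟨φ₁, -, hmono⟩ := strictMono_subseq_of_tendsto_atTop hns
  obtain ⟨φ₂, ν, hφ₂, hν⟩ := exists_isPerturbedLimitAlong_subseq β (periodisedFamily W supp hdep hg hm hb) (ns ∘ φ₁)
  refine ⟨φ₁ ∘ φ₂, ?_⟩
  have hνlim : ν ∈ perturbedLimitPoints β (periodisedFamily W supp hdep hg hm hb) := ⟨_, hmono.comp hφ₂, hν⟩
  have hνG := mem_perturbedGibbsMeasures_of_mem_perturbedLimitPoints hdep hg hm hb hsupp hWc hrange β hνlim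
  rw [← hsub hνG hμ]
  exact hν.2 F S hFS hFc hFb

/-- ★★ **`ℤ⁴`, the gauge-invariant ball: THE THERMODYNAMIC LIMIT OF A MEMBER EXISTS AND IS ITS UNIQUE MASSIVE DLR STATE.**
For `(W, supp) ∈ MemBallZdG ε₀ ε₁ R` with `PerturbedMassGapAt 4 N β W supp` (`N ≥ 1`) there is ONE probability measure `μ`:
`perturbedGibbsMeasures = {μ}`, `μ` is an Osterwalder–Seiler massive state with plaquette–plaquette decay, and the
perturbed torus states of the periodised family converge to `μ` along the FULL sequence `L + 1 → ∞` on every bounded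
continuous cylinder observable. [folklore] -/
theorem tendsto_expectation_periodisedFamily_of_perturbedMassGapAt {W : Potential (ZdEdge 4) (SUN N)}
    {supp : Finset (ZdEdge 4) → Finset (Finset (ZdEdge 4))} (hN : 1 ≤ N) {β ε₀ ε₁ : ℝ} {R : ℕ}
    (hmem : MemBallZdG ε₀ ε₁ R W supp) (hgap : PerturbedMassGapAt 4 N β W supp)
    (hdep : ∀ X, DependsOn (W X) (↑X : Set (ZdEdge 4))) (hg : ∀ X, IsZdGaugeInvariant (W X))
    (hm : ∀ X, Measurable (W X)) (hb : ∀ X, ∃ C, ∀ U, |W X U| ≤ C) :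
    ∃ μ : Measure (LGConfig 4 (SUN N)),
      perturbedGibbsMeasures (d := 4) (fundamentalRep (Fin N)) ((N : ℝ) * β) W supp = {μ} ∧
      IsMassiveState μ ∧ HasExponentialDecay (plaquetteCorrFn (fundamentalRep (Fin N)) μ) ∧
      ∀ (F : LGConfig 4 (SUN N) → ℝ) (S : Finset (ZdEdge 4)), IsCylinder F S → Continuous F → (∃ C, ∀ U, |F U| ≤ C) →
        Tendsto (fun L : ℕ => (periodisedFamily W supp hdep hg hm hb L).expectation (fundamentalRep (Fin N)) ((N : ℝ) * β)
          (toTorusObservable (L + 1) F)) atTop (𝓝 (∫ U, F U ∂μ)) := by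
  obtain ⟨μ, hG, -, hM, hD⟩ := oneState_of_perturbedMassGapAt hN hmem hgap hdep hg hm hb
  have hμ : μ ∈ perturbedGibbsMeasures (d := 4) (fundamentalRep (Fin N)) ((N : ℝ) * β) W supp := by
    rw [hG]; exact Set.mem_singleton μ
  refine ⟨μ, hG, hM, hD, fun F S hFS hFc hFb => ?_⟩
  exact tendsto_expectation_periodisedFamily_of_subsingleton hdep hg hm hb hmem.supportedBy hmem.continuous hmem.range
    _ (by rw [hG]; exact Set.subsingleton_singleton) hμ hFS hFc hFb

end Limit

end Summit.Ventures.YMGap.RobustBall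

end
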